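import Mathlib
import Summits.ValiantsHypothesis.ValiantsHypothesis.Theorems.LacunarySymmetroidMatrixDescartesMonotoneIncoherence
import Summits.ValiantsHypothesis.ValiantsHypothesis.Theorems.LacunarySymmetroidMatrixDescartesInertiaEndInertias

/-!
# `MatrixDescartes` (stmt-ValiantsHypothesis-18050) — THE ONE-SIDED RUNG IS EXACT: a one-sided PSD word with a
# non-degenerate base has EXACTLY `ν(UᵀB⁻¹U)` positive zeros counted with multiplicity — the negative index of the
# Gram matrix of its columns — at every size and for all exponents

HONEST FRAMING.  Cell `pub-symmetroid`, seat `val-sym-mdr-p2` (gen 20); helper file `--supports` the crux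
`Theses.LacunarySymmetroid.MatrixDescartes` (OPEN), NO closure claim; companion of `…MonotoneIncoherence` (positive type,
option-pencil form), `…GramDualInertiaDuality` (`ν(F(x)) + #{σ>0} = ν(B) + π(𝔻(x))`), `…InertiaEndInertias` (end inertia at
`0⁺`) and `…InertiaIndexFormula` (one-type window law).  An EXACT COUNT on the one-sided sector — the sector of the tree's
first rung `firstRung_oneSided` (`Z₊ ≤ m`); nothing here bears on the crux in its window, `stub_twoSided`, `DoorA26` /
`DoorA34`, registers, or `VP ≠ VNP`.

THE THEOREM (`card_posRoots_multiset_eq_negIndex_gram`).  `B` real symmetric with `det B ≠ 0` at exponent `e`; columns `uⱼ`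
with weights `σⱼ > 0` at exponents `δⱼ > e` (PSD letters ABOVE the base).  Then the positive zeros of
`det(X^eB + U diag(σⱼX^{δⱼ}) Uᵀ)` COUNTED WITH MULTIPLICITY number EXACTLY `ν(C)`, `C = UᵀB⁻¹U` the Gram matrix of the
columns in the metric `B⁻¹`.  Consequences: `Z₊ ≤ ν(C) ≤ ν(B) ≤ m` (`…_le_negIndex_gram`, `…_le_negIndex_base`; the tree's
rung and the frame law's count `#{j : uⱼᵀB⁻¹uⱼ < 0}` = `ν(C)` for `C` diagonal are the two extreme cases); `C ⪰ 0 ⇔` no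
positive zero (sterile); e.g. `B = −1_m`, ONE column: `ν(C) = 1` — one zero, not `m`.
PROOF.  Every root is of positive type (`posType_of_monotone`), so between a non-singular scale `a` below all roots and `b`
above them the count is `ν(F(a)) − ν(F(b))` (one-type window law).  Near `0⁺` the word has the inertia of its lowest
letter `B` (end inertia law, `B` non-degenerate, `e` the unique least exponent).  For large `x`: by the duality
`ν(F(x)) = ν(B) + π(𝔻(x)) − R` with `𝔻(x) = x^{E−e}·(diag(σⱼ⁻¹x^{e−δⱼ}) + C) = x^{E−e}·G(1/x)`, `G(s) = diag(σⱼ⁻¹s^{δⱼ−e}) + C`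
continuous at `s = 0` with `G(0) = C`; lower semicontinuity gives `ν(𝔻(x)) ≥ ν(C)` for `x` large, the non-negative
eigenvectors of `C` are a positive family for `𝔻(x)` at every `x` (`π(𝔻(x)) ≥ R − ν(C)`), and `ν + π ≤ R` forces
`π(𝔻(x)) = R − ν(C)`, i.e. `ν(F(x)) = ν(B) − ν(C)`.  Hence the count is `ν(B) − (ν(B) − ν(C)) = ν(C)`.

[folklore] (Sylvester's law of inertia; Sylvester's determinant identity).  Axioms `propext`, `Classical.choice`, `Quot.sound`.
-/

-- layout Summits/ValiantsHypothesis/ValiantsHypothesis forces the duplicated namespace component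
set_option linter.dupNamespace false

namespace Summit.ValiantsHypothesis.ValiantsHypothesis.Theorems.LacunarySymmetroidMatrixDescartes

open Polynomial Matrix Finset
open scoped BigOperators Topology

namespace GramDual

section OneSidedExact

variable {ι ρ : Type} [Fintype ι] [DecidableEq ι] [Fintype ρ] [DecidableEq ρ]

/-- the signed column part (file-local notation, as in `…GramDualSigned`) -/
local notation3 (prettyPrint := false) "𝕊[" U ", " σ ", " δ "]" =>
  ((U : Matrix _ _ ℝ).map Polynomial.C
      * Matrix.diagonal (fun j => Polynomial.C ((σ : _ → ℝ) j) * (Polynomial.X : Polynomial ℝ) ^ (δ j : ℕ))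
      * ((U : Matrix _ _ ℝ).map Polynomial.C)ᵀ)

/-! ## §1  The dual at large scales: `𝔻(x) = x^{E−e}·G(1/x)` with `G` continuous at `0`, `G(0) = C` -/

omit [Fintype ρ] in
/-- The rescaled dual family `G(s) = diag(σⱼ⁻¹ s^{δⱼ−e}) + C` has continuous entries. [folklore] -/
theorem continuous_rescaledDual (C : Matrix ρ ρ ℝ) (σ : ρ → ℝ) (e : ℕ) (δ : ρ → ℕ) (i j : ρ) :
    Continuous fun s : ℝ => (Matrix.diagonal (fun k => (σ k)⁻¹ * s ^ (δ k - e)) + C) i j := by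
  simp only [Matrix.add_apply, Matrix.diagonal_apply]
  split_ifs <;> fun_prop

omit [Fintype ρ] in
/-- `G(0) = C` when every `δⱼ > e`. [folklore] -/
theorem rescaledDual_zero (C : Matrix ρ ρ ℝ) (σ : ρ → ℝ) (e : ℕ) (δ : ρ → ℕ) (hδ : ∀ j, e < δ j) :
    Matrix.diagonal (fun k => (σ k)⁻¹ * (0 : ℝ) ^ (δ k - e)) + C = C := by
  have h : Matrix.diagonal (fun k => (σ k)⁻¹ * (0 : ℝ) ^ (δ k - e)) = 0 := by
    rw [← Matrix.diagonal_zero]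
    congr 1
    funext k
    rw [zero_pow (Nat.sub_ne_zero_of_lt (hδ k)), mul_zero]
  rw [h, zero_add]

omit [Fintype ρ] in
/-- **`𝔻(x) = x^{E−e} · G(x⁻¹)`** for `x ≠ 0`, `e < δⱼ ≤ E`. [folklore] -/
theorem dual_eq_smul_rescaledDual (C : Matrix ρ ρ ℝ) (σ : ρ → ℝ) (E e : ℕ) (δ : ρ → ℕ) (hδ : ∀ j, e < δ j)
    (hδE : ∀ j, δ j ≤ E) {x : ℝ} (hx : x ≠ 0) :
    Matrix.diagonal (fun j => (σ j)⁻¹ * x ^ (E - δ j)) + x ^ (E - e) • C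
      = x ^ (E - e) • (Matrix.diagonal (fun k => (σ k)⁻¹ * x⁻¹ ^ (δ k - e)) + C) := by
  ext i j
  simp only [Matrix.add_apply, Matrix.smul_apply, Matrix.diagonal_apply, smul_eq_mul]
  split_ifs with h
  · subst h
    have hk : E - e = (E - δ i) + (δ i - e) := by have := hδ i; have := hδE i; omega
    have hxp : x ^ (δ i - e) ≠ 0 := pow_ne_zero _ hx
    rw [hk, pow_add, inv_pow]
    field_simp
  · ring

/-! ## §2  The inertia of the dual at large scales -/

/-- **The non-negative eigenvectors of `C` are a positive family for the dual at every scale**: `π(𝔻(x)) ≥ R − ν(C)` for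
all `x > 0` (all `σⱼ > 0`). [folklore] -/
theorem card_nonneg_le_posIndex_dual {B : Matrix ι ι ℝ} (U : Matrix ι ρ ℝ) (σ : ρ → ℝ) (hσ : ∀ j, 0 < σ j) (E e : ℕ)
    (δ : ρ → ℕ) {x : ℝ} (hx : 0 < x) (hC : (Uᵀ * B⁻¹ * U).IsHermitian)
    (hD : (Matrix.diagonal (fun j => (σ j)⁻¹ * x ^ (E - δ j)) + x ^ (E - e) • (Uᵀ * B⁻¹ * U)).IsHermitian) :
    Fintype.card ρ ≤ Fintype.card {j // 0 < hD.eigenvalues j} + Fintype.card {j // hC.eigenvalues j < 0} := by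
  classical
  have h := Inertia.card_le_posIndex hD (fun i : {j // 0 ≤ hC.eigenvalues j} => (hC.eigenvectorBasis i.1).ofLp)
    fun c hc => ?_
  · rw [Inertia.card_nonneg_eigs hC] at h
    have := Fintype.card_subtype_le fun j => hC.eigenvalues j < 0
    omega
  · -- the form splits: diagonal part `> 0`, Gram part `≥ 0`
    set w := ∑ i, c i • (hC.eigenvectorBasis i.1).ofLp with hw
    have hw0 : w ≠ 0 := by
      intro h0
      have hli := Inertia.linearIndependent_subtype_eigen hC (fun j => 0 ≤ hC.eigenvalues j)
      rw [Fintype.linearIndependent_iff] at hli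
      exact hc (funext fun i => hli c h0 i)
    have hgram : 0 ≤ w ⬝ᵥ ((Uᵀ * B⁻¹ * U) *ᵥ w) := Inertia.nonneg_eigenFamily hC c
    have hdiag : 0 < w ⬝ᵥ (Matrix.diagonal (fun j => (σ j)⁻¹ * x ^ (E - δ j)) *ᵥ w) := by
      have hform : w ⬝ᵥ (Matrix.diagonal (fun j => (σ j)⁻¹ * x ^ (E - δ j)) *ᵥ w)
          = ∑ j, (σ j)⁻¹ * x ^ (E - δ j) * w j ^ 2 := by
        rw [dotProduct]
        refine Finset.sum_congr rfl fun j _ => ?_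
        rw [Matrix.mulVec_diagonal]
        ring
      rw [hform]
      obtain ⟨j₀, hj₀⟩ : ∃ j, w j ≠ 0 := by
        by_contra h
        push Not at h
        exact hw0 (funext h)
      have hnonneg : ∀ j ∈ (Finset.univ : Finset ρ), 0 ≤ (σ j)⁻¹ * x ^ (E - δ j) * w j ^ 2 :=
        fun j _ => mul_nonneg (mul_nonneg (inv_pos.2 (hσ j)).le (pow_pos hx _).le) (sq_nonneg _)
      exact lt_of_lt_of_le (mul_pos (mul_pos (inv_pos.2 (hσ j₀)) (pow_pos hx _)) (by positivity))
        (Finset.single_le_sum hnonneg (Finset.mem_univ j₀))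
    rw [Matrix.add_mulVec, dotProduct_add, Matrix.smul_mulVec, dotProduct_smul, smul_eq_mul]
    exact add_pos_of_pos_of_nonneg hdiag (mul_nonneg (pow_pos hx _).le hgram)

/-- **For large scales the dual has `ν(𝔻(x)) ≥ ν(C)`** (lower semicontinuity of the rescaled family at `s = 0`):
there is `N` with `ν(C) ≤ ν(𝔻(x))` for all `x ≥ N`. [folklore] -/
theorem exists_negIndex_dual_ge {B : Matrix ι ι ℝ} (hBs : B.IsSymm) (U : Matrix ι ρ ℝ) (σ : ρ → ℝ) (E e : ℕ)
    (δ : ρ → ℕ) (hδ : ∀ j, e < δ j) (hδE : ∀ j, δ j ≤ E) (hC : (Uᵀ * B⁻¹ * U).IsHermitian) :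
    ∃ N : ℝ, 0 < N ∧ ∀ x : ℝ, N ≤ x →
      Fintype.card {j // hC.eigenvalues j < 0}
        ≤ Fintype.card {j // (isHermitian_eval_dual hBs U σ E e δ x).eigenvalues j < 0} := by
  classical
  set G : ℝ → Matrix ρ ρ ℝ := fun s => Matrix.diagonal (fun k => (σ k)⁻¹ * s ^ (δ k - e)) + (Uᵀ * B⁻¹ * U) with hG
  have hGH : ∀ s, (G s).IsHermitian := fun s =>
    Inertia.isHermitian_of_isSymm ((Matrix.isSymm_diagonal _).add (isSymm_gram hBs U))
  have hsc := Inertia.eventually_negIndex_ge G (continuous_rescaledDual _ σ e δ) hGH 0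
  rw [Metric.eventually_nhds_iff] at hsc
  obtain ⟨ε, hε, hε'⟩ := hsc
  have hG0 : Fintype.card {j // (hGH 0).eigenvalues j < 0} = Fintype.card {j // hC.eigenvalues j < 0} :=
    Inertia.negIndex_congr (hGH 0) hC (rescaledDual_zero _ σ e δ hδ)
  refine ⟨ε⁻¹ + 1, by positivity, fun x hx => ?_⟩
  have hxpos : 0 < x := lt_of_lt_of_le (by positivity) hx
  have hxinv : dist x⁻¹ 0 < ε := by
    rw [Real.dist_eq, sub_zero, abs_of_pos (inv_pos.2 hxpos)]
    calc x⁻¹ ≤ (ε⁻¹ + 1)⁻¹ := by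
          exact inv_anti₀ (by positivity) hx
      _ < (ε⁻¹)⁻¹ := by
          exact inv_strictAnti₀ (by positivity) (lt_add_one _)
      _ = ε := inv_inv ε
  have h1 := hε' hxinv
  rw [hG0] at h1
  -- `𝔻(x) = x^{E−e} • G(x⁻¹)`, positive scaling keeps the index
  have heq : Matrix.diagonal (fun j => (σ j)⁻¹ * x ^ (E - δ j)) + x ^ (E - e) • (Uᵀ * B⁻¹ * U)
      = x ^ (E - e) • G x⁻¹ := dual_eq_smul_rescaledDual _ σ E e δ hδ hδE hxpos.ne'
  have hsmulH : (x ^ (E - e) • G x⁻¹).IsHermitian := by rw [← heq]; exact isHermitian_eval_dual hBs U σ E e δ x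
  have h2 := Inertia.negIndex_smul_pos (hGH x⁻¹) (pow_pos hxpos (E - e)) hsmulH
  have h3 := Inertia.negIndex_congr (isHermitian_eval_dual hBs U σ E e δ x) hsmulH heq
  omega

/-- **The word's negative index at large scales is `ν(B) − ν(C)`** (one-sided PSD word). [folklore] -/
theorem exists_negIndex_word_eq {B : Matrix ι ι ℝ} (hBs : B.IsSymm) (hBu : IsUnit B.det) (U : Matrix ι ρ ℝ)
    (σ : ρ → ℝ) (hσ : ∀ j, 0 < σ j) (e : ℕ) (δ : ρ → ℕ) (hδ : ∀ j, e < δ j) (hB : B.IsHermitian)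
    (hC : (Uᵀ * B⁻¹ * U).IsHermitian) :
    ∃ N : ℝ, 0 < N ∧ ∀ x : ℝ, N ≤ x →
      Fintype.card {j // (isHermitian_eval_word hBs U σ e δ x).eigenvalues j < 0}
          + Fintype.card {j // hC.eigenvalues j < 0}
        = Fintype.card {j // hB.eigenvalues j < 0} := by
  classical
  obtain ⟨E, he, hδE⟩ := exists_bound e δ
  obtain ⟨N, hN, hN'⟩ := exists_negIndex_dual_ge hBs U σ E e δ hδ hδE hC
  refine ⟨N, hN, fun x hx => ?_⟩
  have hxpos : 0 < x := lt_of_lt_of_le hN hx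
  have hD := isHermitian_eval_dual hBs U σ E e δ x
  have hdual := negIndex_word_add_eq hBs hBu U σ (fun j => (hσ j).ne') e E δ he hδE hxpos hB
    (isHermitian_eval_word hBs U σ e δ x) hD
  have hν := hN' x hx
  have hπ := card_nonneg_le_posIndex_dual U σ hσ E e δ hxpos hC hD
  have hcnt := (Inertia.negIndex_add_posIndex_add_corank hD).1
  have hpos : Fintype.card {j // 0 < σ j} = Fintype.card ρ := by
    rw [Fintype.card_subtype, Finset.filter_true_of_mem fun j _ => hσ j, Finset.card_univ]
  rw [hpos] at hdual
  have hle : Fintype.card {j // hC.eigenvalues j < 0} ≤ Fintype.card ρ := Fintype.card_subtype_le _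
  omega

/-! ## §3  The exact count -/

/-- **THE ONE-SIDED RUNG IS EXACT.**  `B` real symmetric with `det B ≠ 0`, weights `σⱼ > 0`, exponents `δⱼ > e`: the
positive zeros of `det(X^eB + U diag(σⱼX^{δⱼ}) Uᵀ)` counted with multiplicity number EXACTLY `ν(UᵀB⁻¹U)` (the negative index of
the Gram matrix, for any hermitian witness `hC`). [folklore] -/
theorem card_posRoots_multiset_eq_negIndex_gram (B : Matrix ι ι ℝ) (hBs : B.IsSymm) (hBu : IsUnit B.det)
    (U : Matrix ι ρ ℝ) (σ : ρ → ℝ) (hσ : ∀ j, 0 < σ j) (e : ℕ) (δ : ρ → ℕ) (hδ : ∀ j, e < δ j)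
    (hC : (Uᵀ * B⁻¹ * U).IsHermitian) :
    Multiset.card ((Matrix.det (((Polynomial.X : Polynomial ℝ) ^ e) • B.map Polynomial.C + 𝕊[U, σ, δ])).roots.filter
        (fun t => 0 < t)) = Fintype.card {j // hC.eigenvalues j < 0} := by
  classical
  have hB : B.IsHermitian := Inertia.isHermitian_of_isSymm hBs
  -- option-pencil presentation
  set Sopt := (fun o : Option ρ => Option.elim o B
    (fun j => σ j • Matrix.vecMulVec (fun a => U a j) (fun a => U a j))) with hSopt
  set dopt := (fun o : Option ρ => Option.elim o e δ) with hdopt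
  have hS : ∀ o, (Sopt o).IsSymm := isSymm_optionLetter hBs U σ
  rw [word_eq_optionPencil B U σ e δ]
  set P := Matrix.det (∑ o : Option ρ, ((Polynomial.X : Polynomial ℝ) ^ dopt o) • (Sopt o).map Polynomial.C) with hPdef
  -- (i) near `0⁺`: inertia of `B`, non-singular
  have hmin : ∀ o : Option ρ, o ≠ none → dopt none < dopt o := by
    intro o ho
    cases o with
    | none => exact absurd rfl ho
    | some j => exact hδ j
  have h0 := Inertia.eventually_nhdsGT_zero_indices_eq dopt Sopt hS none hmin (by exact hBu.ne_zero)
  rw [eventually_nhdsWithin_iff, Metric.eventually_nhds_iff] at h0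
  obtain ⟨ε₀, hε₀, hε₀'⟩ := h0
  have hsmall : ∀ x : ℝ, 0 < x → x < ε₀ →
      Fintype.card {j // (Inertia.isHermitian_pencil dopt Sopt hS x).eigenvalues j < 0}
          = Fintype.card {j // hB.eigenvalues j < 0} ∧ (∑ k, x ^ dopt k • Sopt k).det ≠ 0 := by
    intro x hx hxε
    have h := hε₀' (by rw [Real.dist_eq, sub_zero, abs_of_pos hx]; exact hxε) hx
    exact ⟨h.1, h.2.2⟩
  -- (ii) large scales: `ν(F(x)) = ν(B) − ν(C)`
  obtain ⟨N, hN, hN'⟩ := exists_negIndex_word_eq hBs hBu U σ hσ e δ hδ hB hC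
  -- the scales `a`, `b`
  by_cases hP0 : P = 0
  · -- impossible: `F(a)` is non-singular for small `a`
    exfalso
    have ha := (hsmall (ε₀ / 2) (by positivity) (by linarith)).2
    apply ha
    rw [← DefiniteMoments.eval_det_pencil, ← hPdef, hP0, Polynomial.eval_zero]
  set a : ℝ := ε₀ / 2 with hadef
  set b : ℝ := N + 1 + (P.roots.toFinset.sum fun t => |t|) with hbdef
  have hapos : 0 < a := by rw [hadef]; positivity
  have hsumnn : 0 ≤ P.roots.toFinset.sum fun t => |t| := Finset.sum_nonneg fun t _ => abs_nonneg t
  have hNb : N ≤ b := by rw [hbdef]; linarith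
  have hbpos : 0 < b := lt_of_lt_of_le hN hNb
  have hroot_lt_b : ∀ t ∈ P.roots, t < b := by
    intro t ht
    have hmem : t ∈ P.roots.toFinset := Multiset.mem_toFinset.2 ht
    have h1 : |t| ≤ P.roots.toFinset.sum fun t => |t| :=
      Finset.single_le_sum (f := fun t => |t|) (fun t _ => abs_nonneg t) hmem
    have h2 : t ≤ |t| := le_abs_self t
    rw [hbdef]; linarith
  have hroot_ge : ∀ t ∈ P.roots, 0 < t → ε₀ ≤ t := by
    intro t ht hpos
    by_contra h
    push Not at h
    have hdet := (hsmall t hpos h).2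
    apply hdet
    rw [← DefiniteMoments.eval_det_pencil, ← hPdef]
    exact (Polynomial.mem_roots hP0).1 ht
  rcases lt_or_ge a b with hab | hba
  swap
  · -- degenerate placement `b ≤ a < ε₀`: no positive roots, and `ν(C) = 0`
    have hbε : b < ε₀ := lt_of_le_of_lt hba (by rw [hadef]; linarith)
    have hb1 := hsmall b hbpos hbε
    have hb2 := hN' b hNb
    have hνb := Inertia.negIndex_congr (Inertia.isHermitian_pencil dopt Sopt hS b) (isHermitian_eval_word hBs U σ e δ b)
      (eval_word_eq_optionPencil B U σ e δ b).symm
    have hnone : P.roots.filter (fun t => 0 < t) = 0 := by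
      refine Multiset.filter_eq_nil.2 fun t ht hpos => ?_
      have h1 := hroot_ge t ht hpos
      have h2 := hroot_lt_b t ht
      linarith
    rw [hnone, Multiset.card_zero]
    omega
  have ha : (∑ k, a ^ dopt k • Sopt k).det ≠ 0 := (hsmall a hapos (by rw [hadef]; linarith)).2
  have hb : (∑ k, b ^ dopt k • Sopt k).det ≠ 0 := by
    intro hdet
    have hbroot : b ∈ P.roots := by
      rw [Polynomial.mem_roots hP0, Polynomial.IsRoot.def, hPdef, DefiniteMoments.eval_det_pencil]
      exact hdet
    exact lt_irrefl b (hroot_lt_b b hbroot)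
  -- (iii) one-type window law on `(a, b)`
  have hmono : ∀ j, (0 < σ j ∧ e < δ j) ∨ (σ j < 0 ∧ δ j < e) := fun j => Or.inl ⟨hσ j, hδ j⟩
  have hpos := posType_of_monotone B hBu U σ e δ hmono
  have hwin := (Inertia.card_roots_Ioo_add_negIndex_eq_of_posType dopt Sopt hS hab ha hb
    (fun t hat _ hdet u hu hu0 => hpos t (lt_trans hapos hat) hdet u hu hu0)).1
  rw [← hPdef] at hwin
  -- all positive roots lie in `(a, b)`
  have hfilter : P.roots.filter (fun t => 0 < t) = P.roots.filter (fun t => a < t ∧ t < b) := by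
    refine Multiset.filter_congr fun t ht => ⟨fun hpos' => ⟨?_, hroot_lt_b t ht⟩, fun h => lt_trans hapos h.1⟩
    have := hroot_ge t ht hpos'
    rw [hadef]; linarith
  rw [hfilter]
  -- the end indices
  have hνa := (hsmall a hapos (by rw [hadef]; linarith)).1
  have hνb' := hN' b hNb
  have hνb := Inertia.negIndex_congr (Inertia.isHermitian_pencil dopt Sopt hS b) (isHermitian_eval_word hBs U σ e δ b)
    (eval_word_eq_optionPencil B U σ e δ b).symm
  omega

/-- **`Z₊ ≤ ν(UᵀB⁻¹U)`** (distinct positive zeros) on the one-sided sector. [folklore] -/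
theorem card_posRoots_le_negIndex_gram (B : Matrix ι ι ℝ) (hBs : B.IsSymm) (hBu : IsUnit B.det) (U : Matrix ι ρ ℝ)
    (σ : ρ → ℝ) (hσ : ∀ j, 0 < σ j) (e : ℕ) (δ : ρ → ℕ) (hδ : ∀ j, e < δ j) (hC : (Uᵀ * B⁻¹ * U).IsHermitian) :
    ((Matrix.det (((Polynomial.X : Polynomial ℝ) ^ e) • B.map Polynomial.C + 𝕊[U, σ, δ])).roots.toFinset.filter
        (fun t => 0 < t)).card ≤ Fintype.card {j // hC.eigenvalues j < 0} := by
  classical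
  rw [← card_posRoots_multiset_eq_negIndex_gram B hBs hBu U σ hσ e δ hδ hC, ← Multiset.toFinset_filter]
  exact Multiset.toFinset_card_le _

/-- **`Z₊ ≤ ν(B)`** with multiplicity on the one-sided sector (the Gram index is at most the base index,
`GramDual.negIndex_gram_le`) — the tree's rung `Z₊ ≤ m` sharpened to the negative index of the base, with multiplicity.
[folklore] -/
theorem card_posRoots_multiset_le_negIndex_base (B : Matrix ι ι ℝ) (hBs : B.IsSymm) (hBu : IsUnit B.det)
    (U : Matrix ι ρ ℝ) (σ : ρ → ℝ) (hσ : ∀ j, 0 < σ j) (e : ℕ) (δ : ρ → ℕ) (hδ : ∀ j, e < δ j) (hB : B.IsHermitian) :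
    Multiset.card ((Matrix.det (((Polynomial.X : Polynomial ℝ) ^ e) • B.map Polynomial.C + 𝕊[U, σ, δ])).roots.filter
        (fun t => 0 < t)) ≤ Fintype.card {j // hB.eigenvalues j < 0} := by
  rw [card_posRoots_multiset_eq_negIndex_gram B hBs hBu U σ hσ e δ hδ (isHermitian_gram hBs U)]
  exact negIndex_gram_le hBs hBu hB U (isHermitian_gram hBs U)

end OneSidedExact

end GramDual

end Summit.ValiantsHypothesis.ValiantsHypothesis.Theorems.LacunarySymmetroidMatrixDescartes
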